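import Literature.RepresentationTheory.HeisenbergGroup.SchrodingerPiOperators
import Literature.RepresentationTheory.MoeglinVignerasWaldspurger1987.SBFunctionalInvariantUnderAnisotropicCharacterIsDelta
import HarnessLib

/-!
# A functional on `𝒮(F^ι)` supported at the origin is not a Fourier eigenfunctional (non-archimedean local field; model-agnostic kernel lemma)

[MoeglinVignerasWaldspurger1987] C. Mœglin, M.-F. Vignéras, J.-L. Waldspurger, *Correspondances de Howe sur un corps `p`-adique*, LNM 1291 (1987),
Chap. 2 II.1–II.2 (Schrödinger model: the Weyl element acts on `𝒮(X)` by the Fourier transform), Chap. 3 §IV (rank-one theta dichotomy);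
[WeilBNT1967, Chap. VII §2, Cor. 1] (Fourier transform of the indicator of a coset of a lattice box).  Topic
`RepresentationTheory/MoeglinVignerasWaldspurger1987`; namespace `Literature.RepresentationTheory.MoeglinVignerasWaldspurger1987`.  KERNEL ONLY: two theorems, no
definition, no named fact, no `sorry`.  Cell hodgecm-mathlib, half A line LD2, plate «SOFT-KERNEL» (S2) of LD2-plan (g2) (soft road to the pin (P) of [Liu2021,
Lem. D.1 (1)], B-p04 (g44) memo v3 §3: with (S1) ★-candidate `functional_apply_eq_zero_of_forall_unipOpPi_eq` an `N_Δ`-invariant functional is `c · ev₀`; this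
file: `c · ev₀` is never an eigenvector of the Weyl element `r(w) = 𝓕`, so an `SL₂ ⊃ ⟨N, w⟩`-eigenfunctional vanishes); `--supports stmt-HodgeConjecture-24832`.

THE STATEMENTS.  `F` a non-archimedean local field with a Haar measure `μ`, `ψ` continuous non-trivial of conductor exponent `m`, `ι` a NONEMPTY finite type,
`Λ : 𝒮(F^ι) →ₗ ℂ`.
* `functional_apply_eq_apply_zero_mul` — if `Λ f = 0` whenever `f 0 = 0`, then `Λ g = g(0) · Λ φ` for every `g` and every `φ` with `φ(0) = 1`.
* `functional_eq_zero_of_forall_apply_zero_of_fourierOpPi` — if moreover `Λ (r(w) f) = γ · Λ f` for all `f` (★ `fourierOpPi μ hψ hm`, any `γ : ℂ`), then `Λ = 0`.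
PROOF.  Test against `f = 𝟙_{a + (𝔭^N)^ι}` with `a ∉ (𝔭^N)^ι`: `f 0 = 0` so `Λ f = 0`, while `(r(w) f)(0) = μ((𝔭^N)^ι) ≠ 0` (★
`piFourierSB_indicator_vadd_piPrimePowBall`), whence `Λ 𝟙_{𝒪^ι} = 0`.  (For `ι = ∅` the statement is false: `𝒮(pt) = ℂ`, `r(w) = 1`.)
HONEST LABEL: pure non-archimedean analysis, nothing of [Liu2021] asserted; HC_CM is proved only modulo the 7 printed citations (2 remaining: hLiu418 =
stmt-HodgeConjecture-24832, h413 = stmt-HodgeConjecture-24833) until rung 0 closes; count-neutral.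

## References
* [MoeglinVignerasWaldspurger1987] LNM 1291 (1987), Chap. 2 II.1–II.2; Chap. 3 §IV.
* [WeilBNT1967] A. Weil, *Basic Number Theory* (1967), Chap. VII §2, Cor. 1.
* [Rangarao1993] R. Ranga Rao, Pacific J. Math. 157 (1993), §3.1 (3.9) (the operator `r(w)`).
-/

set_option autoImplicit false

noncomputable section

namespace Literature.RepresentationTheory.MoeglinVignerasWaldspurger1987

open MeasureTheory
open Literature.RepresentationTheory.HeisenbergGroup
open Literature.NumberTheory.Automorphic
open Literature.NumberTheory.GaloisRepresentations.IsNonarchimedeanLocalField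
open scoped Pointwise

variable {F : Type*} [Field F] [ValuativeRel F] [TopologicalSpace F] [IsNonarchimedeanLocalField F]
  {ι : Type*} [Fintype ι] {ψ : AddChar F Circle}

omit [ValuativeRel F] [IsNonarchimedeanLocalField F] [Fintype ι] in
/-- **A FUNCTIONAL SUPPORTED AT `0` IS `ev₀`-PROPORTIONAL**: if `Λ f = 0` whenever `f 0 = 0`, then `Λ g = g(0) · Λ φ` for any `φ` with `φ(0) = 1`.
[cite: MoeglinVignerasWaldspurger1987, Chap. 3 §IV.4] [cite: WeilBNT1967, Chap. VII §2] -/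
theorem functional_apply_eq_apply_zero_mul (Λ : SchwartzBruhat (ι → F) →ₗ[ℂ] ℂ)
    (hΛ0 : ∀ f : SchwartzBruhat (ι → F), (f : (ι → F) → ℂ) 0 = 0 → Λ f = 0) (φ : SchwartzBruhat (ι → F))
    (hφ : (φ : (ι → F) → ℂ) 0 = 1) (g : SchwartzBruhat (ι → F)) : Λ g = (g : (ι → F) → ℂ) 0 * Λ φ := by
  have h : Λ (g - (g : (ι → F) → ℂ) 0 • φ) = 0 := by
    refine hΛ0 _ ?_
    rw [AddSubgroupClass.coe_sub, Submodule.coe_smul, Pi.sub_apply, Pi.smul_apply, hφ, smul_eq_mul, mul_one, sub_self]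
  rwa [map_sub, map_smul, smul_eq_mul, sub_eq_zero] at h

/-- **A FUNCTIONAL SUPPORTED AT `0` IS NOT A FOURIER EIGENFUNCTIONAL**: `Λ f = 0` whenever `f 0 = 0`, and `Λ (r(w) f) = γ Λ f` for all `f`, force
`Λ = 0` (`ι` non-empty). [cite: MoeglinVignerasWaldspurger1987, Chap. 2 II.1–II.2; Chap. 3 §IV.4] [cite: WeilBNT1967, Chap. VII §2, Cor. 1] -/
theorem functional_eq_zero_of_forall_apply_zero_of_fourierOpPi [Nonempty ι] [MeasurableSpace F] [BorelSpace F]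
    (μ : Measure F) [μ.IsAddHaarMeasure] {m : ℤ} (hψ : ψ.IsContinuousNontrivial) (hm : ψ.HasConductorExp m)
    (Λ : SchwartzBruhat (ι → F) →ₗ[ℂ] ℂ) (hΛ0 : ∀ f : SchwartzBruhat (ι → F), (f : (ι → F) → ℂ) 0 = 0 → Λ f = 0)
    (γ : ℂ) (hΛF : ∀ f : SchwartzBruhat (ι → F), Λ (fourierOpPi μ hψ hm f) = γ * Λ f) : Λ = 0 := by
  classical
  haveI : SecondCountableTopology F := secondCountableTopology_localField F
  haveI : T2Space F := (isLocalField F).toT2Space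
  -- the normalising function `φ = 𝟙_{𝒪^ι}`, `φ 0 = 1`
  let φ : SchwartzBruhat (ι → F) :=
    ⟨(piPrimePowBall F ι 0).indicator fun _ => (1 : ℂ), indicator_piPrimePowBall_mem_schwartzBruhat 0 1⟩
  have hφ : (φ : (ι → F) → ℂ) 0 = 1 := by
    change (piPrimePowBall F ι 0).indicator (fun _ => (1 : ℂ)) 0 = 1
    exact Set.indicator_of_mem (zero_mem_piPrimePowBall 0) _
  -- a box `(𝔭^N)^ι` missing the non-zero vector `a = (1, …, 1)`
  let a : ι → F := fun _ => 1
  have ha : a ≠ 0 := fun h => one_ne_zero (congr_fun h (Classical.arbitrary ι))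
  obtain ⟨N, hN⟩ := exists_piPrimePowBall_subset_of_mem_nhds_zero (F := F) (ι := ι) (isOpen_ne.mem_nhds ha.symm)
  have haN : a ∉ piPrimePowBall F ι (N : ℤ) := fun h => hN h rfl
  -- the test function `f = 𝟙_{a + (𝔭^N)^ι}`
  let f : SchwartzBruhat (ι → F) :=
    ⟨(a +ᵥ piPrimePowBall F ι (N : ℤ)).indicator fun _ => (1 : ℂ), indicator_vadd_piPrimePowBall_mem_schwartzBruhat (N : ℤ) a 1⟩
  have hf0 : (f : (ι → F) → ℂ) 0 = 0 := by
    change (a +ᵥ piPrimePowBall F ι (N : ℤ)).indicator (fun _ => (1 : ℂ)) 0 = 0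
    refine Set.indicator_of_notMem (fun h0 => haN ?_) _
    have h' : (0 : ι → F) - a ∈ piPrimePowBall F ι (N : ℤ) := mem_vadd_piPrimePowBall_iff.1 h0
    rw [zero_sub] at h'
    simpa using neg_mem_piPrimePowBall h'
  -- its Fourier transform at `0` is the (positive) measure of the box
  have hFf0 : ((fourierOpPi μ hψ hm f : SchwartzBruhat (ι → F)) : (ι → F) → ℂ) 0 =
      ((Measure.pi fun _ : ι => μ).real (piPrimePowBall F ι (N : ℤ)) : ℂ) := by
    rw [coe_fourierOpPi]
    change piFourierSB ψ (Measure.pi fun _ : ι => μ) ((a +ᵥ piPrimePowBall F ι (N : ℤ)).indicator fun _ => (1 : ℂ)) 0 = _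
    rw [piFourierSB_indicator_vadd_piPrimePowBall _ hm, dotProduct_zero, AddChar.map_zero_eq_one, Circle.coe_one, one_mul,
      if_pos (zero_mem_piPrimePowBall _)]
  have hpos : (0 : ℝ) < (Measure.pi fun _ : ι => μ).real (piPrimePowBall F ι (N : ℤ)) := measureReal_piPrimePowBall_pos _ _
  -- compare `Λ (r(w) f) = γ Λ f = 0` with `Λ (r(w) f) = μ(box) · Λ 𝟙`
  have h1 : Λ (fourierOpPi μ hψ hm f) = 0 := by
    rw [hΛF, functional_apply_eq_apply_zero_mul Λ hΛ0 φ hφ f, hf0, zero_mul, mul_zero]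
  have h2 := functional_apply_eq_apply_zero_mul Λ hΛ0 φ hφ (fourierOpPi μ hψ hm f)
  rw [h1, hFf0] at h2
  have hunit : Λ φ = 0 := by
    rcases mul_eq_zero.1 h2.symm with h | h
    · exact absurd (by exact_mod_cast h) hpos.ne'
    · exact h
  ext g
  rw [functional_apply_eq_apply_zero_mul Λ hΛ0 φ hφ g, hunit, mul_zero, LinearMap.zero_apply]

/-! ## ED. 2 — the combined kernel of the soft road: an `⟨N_Δ, w⟩`-eigenfunctional for an anisotropic form vanishes

Composition of ★ `functional_apply_eq_zero_of_forall_unipOpPi_eq` (ED. 1 of the sister file: invariance under all `r(n(b c))`, `halfForm c`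
anisotropic, `ψ` non-trivial ⇒ `Λ` is supported at `0`) with `functional_eq_zero_of_forall_apply_zero_of_fourierOpPi` above. -/

/-- **THE SOFT-ROAD KERNEL IN ONE NAME**: on `𝒮(F^ι)` (`ι` non-empty), a linear functional `Λ` that is invariant under every unipotent operator
`r(n(b c))` (`b ∈ F`) of an ANISOTROPIC second-degree function `halfForm c` and is an eigenvector of the Fourier operator `r(w)` (any eigenvalue
`γ`) is ZERO.  (`ψ` continuous non-trivial of conductor exponent `m` — so `ψ ≠ 1` somewhere — and locally constant, `hl`.)
[cite: MoeglinVignerasWaldspurger1987, Chap. 2 I.3–I.4, II.1–II.2; Chap. 3 §IV.4] [cite: WeilBNT1967, Chap. VII §2, Cor. 1] -/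
theorem functional_eq_zero_of_forall_unipOpPi_eq_of_fourierOpPi [Nonempty ι] [Invertible (2 : F)] [MeasurableSpace F] [BorelSpace F]
    (μ : Measure F) [μ.IsAddHaarMeasure] {m : ℤ} (hψ : ψ.IsContinuousNontrivial) (hm : ψ.HasConductorExp m)
    (hl : IsLocallyConstant (⇑ψ : F → Circle)) (c : (ι → F) →ₗ[F] (ι → F)) (hc : ∀ x : ι → F, halfForm c x = 0 → x = 0)
    (Λ : SchwartzBruhat (ι → F) →ₗ[ℂ] ℂ) (hΛN : ∀ (b : F) (f : SchwartzBruhat (ι → F)), Λ (unipOpPi hl (b • c) f) = Λ f)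
    (γ : ℂ) (hΛF : ∀ f : SchwartzBruhat (ι → F), Λ (fourierOpPi μ hψ hm f) = γ * Λ f) : Λ = 0 :=
  have hψ1 : ∃ a : F, ((ψ a : Circle) : ℂ) ≠ 1 := by
    obtain ⟨a, -, ha⟩ := hm.2
    exact ⟨a, fun h => ha (Circle.ext h)⟩
  functional_eq_zero_of_forall_apply_zero_of_fourierOpPi μ hψ hm Λ
    (fun f hf0 => functional_apply_eq_zero_of_forall_unipOpPi_eq hl hψ1 c hc Λ hΛN f hf0) γ hΛF

end Literature.RepresentationTheory.MoeglinVignerasWaldspurger1987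

end
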